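import Summits.AnomalousDissipation.AnomalousDissipation.Theorems.MomentParityResolvedDissipationStubLimitSSS
import Summits.AnomalousDissipation.AnomalousDissipation.Theorems.MomentParityResolvedDissipationStubTightExtraction
import Summits.AnomalousDissipation.AnomalousDissipation.Theorems.MomentParityMomentLadderStubClosureAllDegrees
import Summits.AnomalousDissipation.AnomalousDissipation.Theses.Ensemble

/-!
# Crux `MomentParity.MomentLadder` (stmt-AnomalousDissipation-11463), line `Sketch`, lead c2:
# the `N → ∞` bridge — the crux delivers LOUD stationary statistical solutions of the true 3-D
# Navier–Stokes equations, hence the crux `Ensemble.EnsembleZerothLawSomeForce` (stmt-0214) BY NAME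

The crux `X = MomentLadder` speaks about Galerkin levels only: at each viscosity `ν_j` of a sequence
`ν_j → 0` there are a radius `R_j` and a resolution schedule `κ_j` such that for infinitely many levels
`N`, and every moment order `d`, a level-`N` probability law on `H = L²_σ(T³)` supported in `‖u‖ ≤ R_j`,
`κ_j`-resolved, `d`-stationary for Galerkin NS at `(ν_j, f)`, has mean energy `≤ E` and dissipation
`≥ ε`. This file passes to the limit `N → ∞` INSIDE the crux and lands the consequence in the currency of
the Foias–Prodi / Foias–Manley–Rosa–Temam theory (`Torus.IsStationaryStatisticalSolution`, FMRT 2001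
Ch. IV Def. 1.3), which is the currency of the sibling route `Ensemble`:

* `exists_loud_stationaryStatisticalSolution` — at ONE viscosity: from the `∃ᶠ N / ∀ d` witnesses of the
  crux, a stationary statistical solution `μ` of NS at `(ν, f)` supported in the ball `‖u‖ ≤ R`, with
  `∫ |u|² dμ ≤ E`, `ν ∫ ‖∇u‖² dμ ≥ ε` and `∫ ‖∇u‖² dμ ≥ ε/ν` in `ℝ≥0∞`. Proof: moment closure at every
  degree (`stub_closureAllDegrees`, the internal form of the proved item `MomentClosure`) gives ONE
  all-degree-stationary law per level; a sequence of levels `N_i → ∞` is extracted from `∃ᶠ`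
  (`Filter.extraction_of_frequently_atTop`); the resolution clause at `n = 0` and Bernstein give the
  `N`-uniform enstrophy budget `4π²κ(0)²R² + 1`; Rellich–Prokhorov extraction on `H`
  (`stub_tightExtraction`, K2a of the `ResolvedDissipation` line) gives a weakly convergent subsequence,
  and its limit is a stationary statistical solution (`stub_limitIsStationarySolution`, K2b). Loudness
  survives: the energy is a continuous functional bounded on the carrier (clipping), and — the one place
  where the resolution schedule of the crux is used at `n > 0` — the dissipation floor passes to the limit
  through the truncated enstrophies `∫ ‖∇P_{κ(n)} u‖² dμ`, which are continuous bounded functionals on the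
  ball and dominate `ε/ν − 1/(n+1)` at every level, while `‖∇P_K u‖² ≤ ‖∇u‖²` pointwise.
* `ensembleZerothLawAt_of_MomentLadder` — `MomentLadder → ∃ f` smooth div-free mean-zero with
  `Literature.Analysis.FluidPDE.EnsembleZerothLawAt f` (the one-force slice turb.S08 of the ensemble
  zeroth law, Frisch 1995 Ch. 5 law (ii); FMRT 2001 Ch. IV–V), for the ladder's OWN force and viscosities.
* `ensembleZerothLawSomeForce_of_MomentLadder` — **cross-route implication between two route
  declarations**: `MomentParity.MomentLadder → Ensemble.EnsembleZerothLawSomeForce`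
  (stmt-AnomalousDissipation-11463 ⟹ stmt-AnomalousDissipation-0214), and its contrapositive for the
  negatives index. So the crux of route MomentParity sits above BOTH its sibling crux
  `GalerkinInvariantLoud` (stmt-14283, landed `galerkinInvariantLoud_of_MomentLadder`) and the measure-form
  zeroth law of route Ensemble; a refutation of either kills it.

No item is credited (both sides are open); the file is a `--supports` helper of stmt-11463.

References: Foias–Manley–Rosa–Temam, *Navier–Stokes Equations and Turbulence* (CUP 2001), Ch. IV §1.2
Def. 1.3, (1.29)–(1.31), Ch. IV App. B (Galerkin limits of invariant measures); Billingsley,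
*Convergence of Probability Measures*, Thms 2.1, 5.1; Frisch, *Turbulence* (CUP 1995), Ch. 5 law (ii).
-/

noncomputable section

-- `Summit.<Summit>.<Problem>`: single-conjunct summit, the duplicate namespace segment is mandated.
set_option linter.dupNamespace false

namespace Summit.AnomalousDissipation.AnomalousDissipation.Theorems.MomentLadder

open MeasureTheory Filter Topology Set
open scoped ENNReal NNReal
open Literature.Analysis.FunctionSpaces Literature.Analysis.FluidPDE
open Summit.AnomalousDissipation.AnomalousDissipation.Theses.MomentParity
open Summit.AnomalousDissipation.AnomalousDissipation.Theorems.QuarticGate.Negative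
open Summit.AnomalousDissipation.AnomalousDissipation.Theorems.MomentLadder.Negative
open Summit.AnomalousDissipation.AnomalousDissipation.Theorems.MomentParityResolvedDissipation

/-! ## The `N`-uniform enstrophy budget of a supported resolved law -/

/-- A probability law supported in `‖u‖ ≤ R` whose enstrophy is `κ`-resolved has mean enstrophy
`≤ 4π² κ(0)² R² + 1` (resolution at `n = 0` and Bernstein for the truncation). Level and stationarity
are not used. [folklore] -/
theorem ensembleEnstrophy_le_of_isSupported_isResolved {R : ℝ} {κ : ℕ → ℕ}
    {μ : Measure (Torus.energySpace (Fin 3))} [IsProbabilityMeasure μ]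
    (hR : IsSupported R μ) (hκ : IsResolved κ μ) :
    Torus.ensembleEnstrophy μ ≤ ENNReal.ofReal (4 * Real.pi ^ 2 * (κ 0 : ℝ) ^ 2 * R ^ 2 + 1) := by
  have h1 := hκ.ensembleEnstrophy_le 0
  have h0 : (((0 : ℕ) : ℝ≥0∞) + 1)⁻¹ = 1 := by simp
  rw [h0] at h1
  have h2 : ∫⁻ u, ‖u‖ₑ ^ 2 ∂μ ≤ ENNReal.ofReal (R ^ 2) := by
    calc ∫⁻ u, ‖u‖ₑ ^ 2 ∂μ ≤ ∫⁻ _, ENNReal.ofReal (R ^ 2) ∂μ :=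
          lintegral_mono_ae (Filter.Eventually.mono hR fun u hu => by
            rw [← ofReal_norm, ← ENNReal.ofReal_pow (norm_nonneg _)]
            exact ENNReal.ofReal_le_ofReal (pow_le_pow_left₀ (norm_nonneg _) hu 2))
      _ = ENNReal.ofReal (R ^ 2) := by rw [lintegral_const, measure_univ, mul_one]
  calc Torus.ensembleEnstrophy μ
      ≤ ENNReal.ofReal (4 * Real.pi ^ 2 * (κ 0 : ℝ) ^ 2) * (∫⁻ u, ‖u‖ₑ ^ 2 ∂μ) + 1 := h1
    _ ≤ ENNReal.ofReal (4 * Real.pi ^ 2 * (κ 0 : ℝ) ^ 2) * ENNReal.ofReal (R ^ 2) + 1 := by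
        gcongr
    _ = ENNReal.ofReal (4 * Real.pi ^ 2 * (κ 0 : ℝ) ^ 2 * R ^ 2 + 1) := by
        rw [← ENNReal.ofReal_mul (by positivity), ENNReal.ofReal_add (by positivity) zero_le_one,
          ENNReal.ofReal_one]

/-- `a ≤ b + 1/(n+1)` for every `n` forces `a ≤ b` (in `ℝ≥0∞`). [folklore] -/
theorem ENNReal.le_of_forall_le_add_inv_succ {a b : ℝ≥0∞} (h : ∀ n : ℕ, a ≤ b + ((n : ℝ≥0∞) + 1)⁻¹) :
    a ≤ b := by
  have h0 : Tendsto (fun n : ℕ => b + ((n : ℝ≥0∞) + 1)⁻¹) atTop (𝓝 b) := by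
    have hc := ENNReal.tendsto_inv_nat_nhds_zero.comp (tendsto_add_atTop_nat 1)
    have h' : Tendsto (fun n : ℕ => ((n : ℝ≥0∞) + 1)⁻¹) atTop (𝓝 0) :=
      hc.congr fun n => by simp [Function.comp]
    simpa using h'.const_add b
  exact ge_of_tendsto' h0 h

/-! ## One viscosity: a loud stationary statistical solution from the ladder witnesses -/

/-- **Loud stationary statistical solutions from the crux witnesses at one viscosity.** Let `f` be
smooth, `0 < ν`, `0 < ε`, and suppose that for infinitely many levels `N` and every order `d` there is a
ladder witness (`IsLadderWitness f ν N E ε R κ d μ`: level-`N` probability law supported in `‖u‖ ≤ R`,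
`κ`-resolved, `d`-stationary for Galerkin NS at `(ν, f)`, energy `≤ E`, dissipation `≥ ε`). Then there
is a stationary statistical solution `μ` of the Navier–Stokes equations at `(ν, f)` (FMRT 2001 Ch. IV
Def. 1.3) supported in the same ball, with integrable energy `∫ |u|² dμ ≤ E`, dissipation
`ν ∫ ‖∇u‖² dμ ≥ ε`, `∫ ‖∇u‖² dμ ≥ ε/ν` in `ℝ≥0∞`, AND THE MEAN ENERGY EQUALITY
`ν ∫ ‖∇u‖² dμ = ∫ (u, f) dμ` (FMRT IV (1.31) with equality — known in print only in 2-D; here it is what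
the resolution schedule of the crux buys in 3-D). Moment closure at every degree, extraction of levels
`N_i → ∞`, Rellich–Prokhorov (K2a) and limit-is-SSS (K2b); the energy passes to the limit by clipping, the
dissipation floor and the lower energy inequality through the truncated enstrophies (continuous bounded on
the carrier, dominating `‖∇u‖² − 1/(n+1)` in the mean at every level by resolution), the upper energy
inequality is FMRT's (`IsStationaryStatisticalSolution.energy_le_holds`). [folklore] -/
theorem exists_loud_stationaryStatisticalSolution
    {f : UnitAddTorus (Fin 3) → EuclideanSpace ℝ (Fin 3)} (hfs : Torus.IsSmooth f)
    {ν : ℝ} (hν : 0 < ν) {E ε : ℝ} (hε : 0 < ε) {R : ℝ} {κ : ℕ → ℕ}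
    (h : ∃ᶠ N in atTop, ∀ d : ℕ, ∃ μ : Measure (Torus.energySpace (Fin 3)),
      IsLadderWitness f ν N E ε R κ d μ) :
    ∃ μ : Measure (Torus.energySpace (Fin 3)),
      Torus.IsStationaryStatisticalSolution ν f μ ∧
      Integrable (fun u : Torus.energySpace (Fin 3) => ‖u‖ ^ 2) μ ∧
      (∀ᵐ u ∂μ, ‖u‖ ≤ R) ∧
      Torus.ensembleEnergy μ ≤ E ∧ ε ≤ Torus.ensembleDissipation ν μ ∧
      ENNReal.ofReal (ε / ν) ≤ Torus.ensembleEnstrophy μ ∧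
      ν * (Torus.ensembleEnstrophy μ).toReal = ∫ u, Torus.pairing u.1 f ∂μ := by
  -- levels `N_i → ∞` carrying witnesses of every order, closed in `d`
  obtain ⟨Ns, hNs, hP⟩ := extraction_of_frequently_atTop h
  choose μ hp hl hsupp hres hstat hE hD using
    fun i => stub_closureAllDegrees f hfs ν (Ns i) E ε R κ (hP i)
  -- the `N`-uniform enstrophy budget
  have hM : ∀ i, Torus.ensembleEnstrophy (μ i) ≤
      (((4 * Real.pi ^ 2 * (κ 0 : ℝ) ^ 2 * R ^ 2 + 1).toNNReal : ℝ≥0) : ℝ≥0∞) := fun i => by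
    haveI := hp i
    exact ensembleEnstrophy_le_of_isSupported_isResolved (hsupp i) (hres i)
  -- Rellich–Prokhorov extraction (K2a)
  obtain ⟨φ, hφ, μlim, hplim, hball, hBC, hLSC, hTE, hPI⟩ :=
    TightExtraction.stub_tightExtraction R _ μ hp (fun i => hsupp i) hM
  haveI := hplim
  -- the limit is a stationary statistical solution (K2b)
  have hSSS : Torus.IsStationaryStatisticalSolution ν f μlim :=
    LimitSSS.stub_limitIsStationarySolution ν f R hν (hfs.memLp 2) (Ns ∘ φ) (fun i => μ (φ i))
      (fun i => hp (φ i)) (fun i => hl (φ i)) (fun i => hsupp (φ i)) (fun i d => hstat (φ i) d)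
      (hNs.tendsto_atTop.comp hφ.tendsto_atTop) μlim hplim hball hBC hLSC
  -- energy ceiling of the limit (clipping on the carrier)
  have hEn : Torus.ensembleEnergy μlim ≤ E := by
    have ht : Tendsto (fun i => ∫ u, ‖u‖ ^ 2 ∂(μ (φ i))) atTop (𝓝 (∫ u, ‖u‖ ^ 2 ∂μlim)) :=
      TightExtraction.tendsto_integral_of_forall_bounded_continuous hBC (S := {u | ‖u‖ ≤ R}) hball
        (fun i => hsupp (φ i)) (continuous_norm.pow 2) (B := R ^ 2) fun u hu => by
          rw [abs_of_nonneg (by positivity)]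
          exact pow_le_pow_left₀ (norm_nonneg _) hu 2
    exact le_of_tendsto' ht fun i => hE (φ i)
  -- the floor `ε/ν ≤ ∫ ‖∇P_{κ n} u‖² dμ_i + 1/(n+1)` at every level (dissipation ≥ ε and resolution)
  have hfloor_i : ∀ i (n : ℕ), ENNReal.ofReal (ε / ν) ≤
      (∫⁻ u, Torus.eGradNormSq (Torus.fourierTruncate (κ n)
        (u.1 : UnitAddTorus (Fin 3) → EuclideanSpace ℝ (Fin 3))) ∂(μ i)) + ((n : ℝ≥0∞) + 1)⁻¹ := by
    intro i n
    have hZ : ENNReal.ofReal (ε / ν) ≤ Torus.ensembleEnstrophy (μ i) := by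
      have hd := hD i
      unfold Torus.ensembleDissipation at hd
      have hne : Torus.ensembleEnstrophy (μ i) ≠ ⊤ := by
        intro htop
        rw [htop, ENNReal.toReal_top, mul_zero] at hd
        exact absurd hd (not_le.2 hε)
      rw [ENNReal.ofReal_le_iff_le_toReal hne, div_le_iff₀ hν, mul_comm]
      exact hd
    exact hZ.trans (hres i n)
  -- passes to the limit through the truncated enstrophies, then `n → ∞`
  have hfloor : ENNReal.ofReal (ε / ν) ≤ Torus.ensembleEnstrophy μlim := by
    have hint : ∀ u : Torus.energySpace (Fin 3),
        Integrable (u.1 : UnitAddTorus (Fin 3) → EuclideanSpace ℝ (Fin 3)) volume :=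
      fun u => (Lp.memLp u.1).integrable one_le_two
    have h1 : ∀ n : ℕ, ENNReal.ofReal (ε / ν) ≤ Torus.ensembleEnstrophy μlim + ((n : ℝ≥0∞) + 1)⁻¹ := by
      intro n
      have h2 : ENNReal.ofReal (ε / ν) ≤ (∫⁻ u, Torus.eGradNormSq (Torus.fourierTruncate (κ n)
          (u.1 : UnitAddTorus (Fin 3) → EuclideanSpace ℝ (Fin 3))) ∂μlim) + ((n : ℝ≥0∞) + 1)⁻¹ :=
        ge_of_tendsto' ((hTE (κ n)).add_const _) fun i => hfloor_i (φ i) n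
      refine h2.trans (add_le_add (lintegral_mono fun u => ?_) le_rfl)
      exact Torus.eGradNormSq_fourierTruncate_le (hint u) (κ n)
    exact ENNReal.le_of_forall_le_add_inv_succ h1
  -- dissipation floor of the limit
  have hne : Torus.ensembleEnstrophy μlim ≠ ⊤ := hSSS.enstrophy_finite.ne
  have hDiss : ε ≤ Torus.ensembleDissipation ν μlim := by
    have h3 := (ENNReal.ofReal_le_iff_le_toReal hne).1 hfloor
    rw [div_le_iff₀ hν] at h3
    unfold Torus.ensembleDissipation
    linarith [mul_comm (Torus.ensembleEnstrophy μlim).toReal ν]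
  -- the mean energy EQUALITY of the limit
  have hf2 : MemLp f 2 volume := hfs.memLp 2
  have hEq : ν * (Torus.ensembleEnstrophy μlim).toReal = ∫ u, Torus.pairing u.1 f ∂μlim := by
    refine le_antisymm (Torus.IsStationaryStatisticalSolution.energy_le_holds hSSS hf2) ?_
    -- at level `N_{φ i}`: `∫ ‖∇u‖² dμ = ofReal ((∫ (u,f) dμ) / ν)` (energy row, finite enstrophy)
    have hrow : ∀ i, Torus.ensembleEnstrophy (μ (φ i)) =
        ENNReal.ofReal ((∫ u, Torus.pairing u.1 f ∂(μ (φ i))) / ν) := by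
      intro i
      haveI := hp (φ i)
      have hd := hD (φ i)
      have hne' : Torus.ensembleEnstrophy (μ (φ i)) ≠ ⊤ := by
        intro htop
        unfold Torus.ensembleDissipation at hd
        rw [htop, ENNReal.toReal_top, mul_zero] at hd
        exact absurd hd (not_le.2 hε)
      have heq := ensembleDissipation_eq_of_polyStationary f hf2 (hl (φ i))
        (integrable_norm_pow_of_isSupported (hsupp (φ i)) 2) le_rfl (hstat (φ i) 3)
      unfold Torus.ensembleDissipation at heq
      rw [← ENNReal.ofReal_toReal hne']
      congr 1
      field_simp
      linarith
    -- resolution: `ofReal (P_i/ν) ≤ ∫ ‖∇P_{κ n}u‖² dμ_i + 1/(n+1)`; pass to the limit in `i`, then `n`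
    have hP : Tendsto (fun i => ENNReal.ofReal ((∫ u, Torus.pairing u.1 f ∂(μ (φ i))) / ν)) atTop
        (𝓝 (ENNReal.ofReal ((∫ u, Torus.pairing u.1 f ∂μlim) / ν))) :=
      (ENNReal.continuous_ofReal.tendsto _).comp ((hPI f hf2).div_const ν)
    have hint : ∀ u : Torus.energySpace (Fin 3),
        Integrable (u.1 : UnitAddTorus (Fin 3) → EuclideanSpace ℝ (Fin 3)) volume :=
      fun u => (Lp.memLp u.1).integrable one_le_two
    have h1 : ∀ n : ℕ, ENNReal.ofReal ((∫ u, Torus.pairing u.1 f ∂μlim) / ν) ≤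
        Torus.ensembleEnstrophy μlim + ((n : ℝ≥0∞) + 1)⁻¹ := by
      intro n
      have h2 : ENNReal.ofReal ((∫ u, Torus.pairing u.1 f ∂μlim) / ν) ≤
          (∫⁻ u, Torus.eGradNormSq (Torus.fourierTruncate (κ n)
            (u.1 : UnitAddTorus (Fin 3) → EuclideanSpace ℝ (Fin 3))) ∂μlim) + ((n : ℝ≥0∞) + 1)⁻¹ :=
        le_of_tendsto_of_tendsto' hP ((hTE (κ n)).add_const _) fun i =>
          (hrow i).symm.le.trans (hres (φ i) n)
      refine h2.trans (add_le_add (lintegral_mono fun u => ?_) le_rfl)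
      exact Torus.eGradNormSq_fourierTruncate_le (hint u) (κ n)
    have h3 := (ENNReal.ofReal_le_iff_le_toReal hne).1 (ENNReal.le_of_forall_le_add_inv_succ h1)
    rwa [div_le_iff₀ hν, mul_comm] at h3
  exact ⟨μlim, hSSS, integrable_norm_pow_of_isSupported hball 2, hball, hEn, hDiss, hfloor, hEq⟩

/-! ## The bridge to route `Ensemble` -/

/-- **`MomentLadder` gives the ensemble zeroth law for its own force**: if the crux holds with force `f`,
viscosities `ν_j → 0` and budgets `E`, `ε`, then `f` is smooth, divergence free, mean zero and satisfies
`EnsembleZerothLawAt f` (Literature turb.S08 slice: stationary statistical solutions `μ_j` of NS at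
`(ν_j, f)` with integrable, uniformly bounded mean energy and dissipation `≥ ε > 0`) — with the SAME
`ν_j`, `E`, `ε`. [folklore] -/
theorem ensembleZerothLawAt_of_MomentLadder (h : MomentLadder) :
    ∃ f : UnitAddTorus (Fin 3) → EuclideanSpace ℝ (Fin 3),
      Torus.IsSmooth f ∧ Torus.IsDivFree f ∧ Torus.HasZeroMean f ∧ EnsembleZerothLawAt f := by
  obtain ⟨f, hfs, hfd, hfz, ν, E, ε, hν, hν0, hε, hj⟩ := momentLadder_iff.1 h
  refine ⟨f, hfs, hfd, hfz, ?_⟩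
  have hμ : ∀ j, ∃ μ : Measure (Torus.energySpace (Fin 3)),
      Torus.IsStationaryStatisticalSolution (ν j) f μ ∧
      Integrable (fun u : Torus.energySpace (Fin 3) => ‖u‖ ^ 2) μ ∧
      Torus.ensembleEnergy μ ≤ E ∧ ε ≤ Torus.ensembleDissipation (ν j) μ := by
    intro j
    obtain ⟨R, κ, hfreq⟩ := hj j
    obtain ⟨μ, hS, hI, -, hE, hD, -, -⟩ := exists_loud_stationaryStatisticalSolution hfs (hν j) hε hfreq
    exact ⟨μ, hS, hI, hE, hD⟩
  choose μ hS hI hE hD using hμ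
  exact ⟨ν, μ, hν, hν0, hS, hI, ⟨E, hE⟩, ε, hε, hD⟩

/-- **`MomentParity.MomentLadder → Ensemble.EnsembleZerothLawSomeForce`** — unconditional implication
between two route declarations (both open cruxes): the crux of route MomentParity
(stmt-AnomalousDissipation-11463, loud resolved Galerkin-invariant measures along `ν_j → 0`) implies the
crux of route Ensemble (stmt-AnomalousDissipation-0214, the zeroth law in Foias–Prodi measure form), by
the `N → ∞` passage `ensembleZerothLawAt_of_MomentLadder`. Credits no item. [folklore] -/
theorem ensembleZerothLawSomeForce_of_MomentLadder :
    MomentLadder →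
      Summit.AnomalousDissipation.AnomalousDissipation.Theses.Ensemble.EnsembleZerothLawSomeForce :=
  ensembleZerothLawAt_of_MomentLadder

/-- Contrapositive, for the negatives index: a refutation of the Ensemble crux (stmt-0214) refutes the
MomentParity crux (stmt-11463). [folklore] -/
theorem not_MomentLadder_of_not_ensembleZerothLawSomeForce
    (h : ¬ Summit.AnomalousDissipation.AnomalousDissipation.Theses.Ensemble.EnsembleZerothLawSomeForce) :
    ¬ MomentLadder :=
  fun hM => h (ensembleZerothLawSomeForce_of_MomentLadder hM)

end Summit.AnomalousDissipation.AnomalousDissipation.Theorems.MomentLadder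

end
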